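import Mathlib
import Summits.ResolutionOfSingularities.ResolutionOfSingularities.Theses.PAlteration
import Summits.ResolutionOfSingularities.ResolutionOfSingularities.Theorems.PAlterationPicoverLocalModelTransversal

/-!
Sketch (crux-ideate, ideator 2, crux stmt-ResolutionOfSingularities-0557 `PicoverLocalModel`):
first-lemma signatures of the two idea cards. Not proofs (sorry); they must only elaborate.
-/

set_option linter.dupNamespace false

open Polynomial AlgebraicGeometry CategoryTheory Literature.AlgebraicGeometry.Resolution

namespace Summit.ResolutionOfSingularities.ResolutionOfSingularities.Cruxes.PicoverLocalModel.SketchIdeator2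

/-! ## Card `giraud-normal-form-log-regular-endgame` -/

/-- First lemma (modification transfer): the local model pulled back to a proper birational
integral modification `W → Spec R` of the base is proper and birational over the local model
(finite flat base change of a birational map from an integral, Cohen–Macaulay total space), so a
resolution of the pulled-back model resolves the model. -/
theorem hasResolution_localModel_of_modification {R : Type} [CommRing R] [IsDomain R]
    [IsIntegrallyClosed R] (p : ℕ) [Fact p.Prime] [CharP R p] (a : R) (ha : ∀ b : R, b ^ p ≠ a)
    (W : Scheme.{0}) (π : W ⟶ Spec (.of R)) [IsProper π] (hπ : IsBirational π) [IsIntegral W]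
    (h : Scheme.HasResolution
      (Limits.pullback
        (Spec.map (CommRingCat.ofHom (algebraMap R (AdjoinRoot ((X : R[X]) ^ p - C a))))) π)) :
    Scheme.HasResolution (Spec (.of (AdjoinRoot ((X : R[X]) ^ p - C a)))) := by
  sorry

/-- Stub candidate (global toric exit, the simplest Giraud normal form `a = x^M`, `p ∤ M i₀`,
over affine space): the binomial hypersurface `t^p = x^M` has a resolution (its normalisation is
the affine toric variety of the cone `ℝ^n_{≥0}` for the lattice `pℤ^n + ℤM`; KKMS / Kato–Nizioł). -/
theorem hasResolution_localModel_monomial (p : ℕ) [Fact p.Prime] (k : Type) [Field k] [CharP k p]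
    (n : ℕ) (M : Fin n →₀ ℕ) (i₀ : Fin n) (hM : ¬ p ∣ M i₀) :
    Scheme.HasResolution (Spec (.of
      (AdjoinRoot ((X : (MvPolynomial (Fin n) k)[X]) ^ p - C (MvPolynomial.monomial M 1)) ⧸
        nilradical (AdjoinRoot ((X : (MvPolynomial (Fin n) k)[X]) ^ p -
          C (MvPolynomial.monomial M 1)))))) := by
  sorry

/-! ## Card `fierce-divisors-inherit-the-crux` -/

/-- First lemma (fierce inheritance, local form): `S` regular local of characteristic `p`,
`x` a regular parameter (`E = V(x)` regular), `v ∈ S`; if on `E` some (absolute) derivation takes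
the restriction `v̄` to a unit, then the local model `S[T]/(T^p - v)` is already regular (lift the
derivation to the completion `K⟦x, y⟧`, Stacks 07PG there, faithfully flat descent). -/
theorem isRegularRing_localModel_of_derivation_quotient {S : Type} [CommRing S]
    [IsRegularLocalRing S] (p : ℕ) [Fact p.Prime] [CharP S p] (x v : S)
    (hx : x ∈ IsLocalRing.maximalIdeal S) (hx2 : x ∉ (IsLocalRing.maximalIdeal S) ^ 2)
    (hD : ∃ D : Derivation ℤ (S ⧸ Ideal.span {x}) (S ⧸ Ideal.span {x}),
      IsUnit (D (Ideal.Quotient.mk (Ideal.span {x}) v))) :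
    IsRegularRing (AdjoinRoot ((X : S[X]) ^ p - C v)) := by
  sorry

/-- Corollary shape (fierce exceptional divisor of multiplicity `p·m`): the reduced local model of
`a = x^{p m} · v` has a resolution as soon as `v̄ = v|_E` is transversal on `E = V(x)` — its
normalisation is the (regular) model of `v`, via `t ↦ t / x^m`. -/
theorem hasResolution_localModel_fierce {S : Type} [CommRing S] [IsDomain S]
    [IsRegularLocalRing S] (p : ℕ) [Fact p.Prime] [CharP S p] (x v : S) (m : ℕ)
    (hx : x ∈ IsLocalRing.maximalIdeal S) (hx2 : x ∉ (IsLocalRing.maximalIdeal S) ^ 2)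
    (hD : ∃ D : Derivation ℤ (S ⧸ Ideal.span {x}) (S ⧸ Ideal.span {x}),
      IsUnit (D (Ideal.Quotient.mk (Ideal.span {x}) v))) :
    Scheme.HasResolution (Spec (.of
      (AdjoinRoot ((X : S[X]) ^ p - C (x ^ (p * m) * v)) ⧸
        nilradical (AdjoinRoot ((X : S[X]) ^ p - C (x ^ (p * m) * v)))))) := by
  sorry

end Summit.ResolutionOfSingularities.ResolutionOfSingularities.Cruxes.PicoverLocalModel.SketchIdeator2
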